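import Summits.QuantumFields.YangMills.Theorems.SwapTwistDeficitSmallBallFloors
import Summits.QuantumFields.YangMills.Theorems.SwapTwistTraceDefs
import HarnessLib

/-!
# The twist ratio decays NO FASTER than `β^{−1/2}/log β` at fixed `L` — the lower half of the prediction `⟨S⟩ ≍ β^{−1/2}/log β`,
# PARAMETRIC in the periodic ceiling and the swap floor
# (free-hands support of item stmt-QuantumFields-24197 `SwapVirialDeficit.SwapGluedStiffness`; sequel row of the CLOSED item ⟨stmt-QuantumFields-23802⟩
# `TwistRatioVanishesFixedL`; §3 of seat w2 g54's stratum census SWAP-STRATA (evidence #2 on ⟨23802⟩): `Z ≍ e^{12βL⁴}β^{−(9L⁴−3/2)}·log β`,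
# `Z^S ≍ e^{12βL⁴}β^{−(9L⁴−1)}`, hence `⟨S⟩ = Z^S/Z ≍ β^{−1/2}/log β`)

The fixed-`L` large-`β` asymptotics of the two femto-ring traces are being assembled by the cell ym-idea-1 (2026-08-31) from four one-sided bricks:
the periodic FLOOR with its logarithm (✓`PeriodicRingFloor.log_physTrace_floor`, w3 g61 + this seat's ✓`ToronLog`), the periodic CEILING with its logarithm
(fcl-p3 g43, in progress), the swap FLOOR without logarithm (w3 g61's (α2-v) + this seat's ✓`NearlyCommutingThreeFloor` ∕ ✓`SigmaTwistedLetterFloor`), and the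
swap CEILING (open).  This file records, PARAMETRICALLY in the two bricks it needs, the consequence for the twist ratio `⟨S⟩_β = Z^S/Z`:

* ★ `twistRatio_floor_of_bounds` — from ANY ceiling `Z = TT.physTrace L β (2L) ≤ C·e^{12βL⁴}·β^{−(9L⁴−3/2)}·log β` (`β ≥ β₁`) and ANY floor
  `c·e^{12βL⁴}·β^{−(9L⁴−1)} ≤ Z^S = TT.twistTrace L β (2L)` (`β ≥ β₂`): `(c/C)·β^{−1/2}/log β ≤ Z^S/Z` for `β ≥ max(β₁, β₂, 2)`;
* `twistRatio_floor_of_exists` — the `∃`-packaged form.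

So once both bricks land, `⟨S⟩_β → 0` (✓⟨23802⟩) happens NO FASTER than `β^{−1/2}/log β` at each fixed `L ≥ 1`; the matching UPPER bound `⟨S⟩ ≤ C_L·β^{−1/2}/log β`
needs the swap ceiling and the periodic floor (the latter landed).
HONEST LABEL: real-number bookkeeping for a fixed-`L` prediction row, conditional on two inputs of the stated shapes (one in progress, one in progress);
nothing about ⟨24197⟩, ⟨24194⟩, ⟨24497⟩, ⟨24196⟩ or any rung is proved; the Yang–Mills mass gap is NOT proved; no summit is proved by a line.
THEOREMS ONLY (0 `def`, 0 `sorry`), standard axioms.  Width seat ym-line-sfw-p2-w2 g54 (cell ym-idea-1, free hands), `--supports stmt-QuantumFields-24197`.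
References: [cite: Luscher1983, §2]; [cite: Vanbaal2001]; [cite: GonzalezarroyoAltes1988]; [folklore].
-/

set_option autoImplicit false

noncomputable section

namespace Summit.QuantumFields.YangMills.Theorems.SwapTwistDeficit.TwistRatioFloor

open Summit.QuantumFields.YangMills.Theorems.FemtoTransferGap

variable {L : ℕ} [NeZero L]

/-- ★ **The twist ratio decays no faster than `β^{−1/2}/log β` (parametric).**  If `Z ≤ C·e^{12βL⁴}β^{−(9L⁴−3/2)}·log β` for `β ≥ β₁` and
`c·e^{12βL⁴}β^{−(9L⁴−1)} ≤ Z^S` for `β ≥ β₂` (`c, C > 0`), then `(c/C)·β^{−1/2}/log β ≤ Z^S/Z` for `β ≥ max(max β₁ β₂, 2)`. [folklore] -/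
theorem twistRatio_floor_of_bounds (hL : 1 ≤ L) {c C β₁ β₂ : ℝ} (hc : 0 < c) (hC : 0 < C)
    (hceil : ∀ β : ℝ, β₁ ≤ β →
      TT.physTrace L β (2 * L) ≤ C * Real.exp (12 * β * (L : ℝ) ^ 4) * β ^ (-(9 * (L : ℝ) ^ 4 - 3 / 2)) * Real.log β)
    (hfloor : ∀ β : ℝ, β₂ ≤ β →
      c * Real.exp (12 * β * (L : ℝ) ^ 4) * β ^ (-(9 * (L : ℝ) ^ 4 - 1)) ≤ TT.twistTrace L β (2 * L)) :
    ∀ β : ℝ, max (max β₁ β₂) 2 ≤ β →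
      c / C * (β ^ (-(1 / 2 : ℝ)) / Real.log β) ≤ TT.twistTrace L β (2 * L) / TT.physTrace L β (2 * L) := by
  intro β hβ
  have hβ₁ : β₁ ≤ β := le_trans (le_trans (le_max_left _ _) (le_max_left _ _)) hβ
  have hβ₂ : β₂ ≤ β := le_trans (le_trans (le_max_right _ _) (le_max_left _ _)) hβ
  have hβ2 : 2 ≤ β := le_trans (le_max_right _ _) hβ
  have hβ0 : 0 < β := by linarith
  have hlog : 0 < Real.log β := Real.log_pos (by linarith)
  have hE : 0 < Real.exp (12 * β * (L : ℝ) ^ 4) := Real.exp_pos _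
  have hpa : 0 < β ^ (-(9 * (L : ℝ) ^ 4 - 3 / 2)) := Real.rpow_pos_of_pos hβ0 _
  have hZ : 0 < TT.physTrace L β (2 * L) := TT.physTrace_two_mul_pos hL (by linarith)
  have hU := hceil β hβ₁
  have hV := hfloor β hβ₂
  have hV0 : 0 ≤ c * Real.exp (12 * β * (L : ℝ) ^ 4) * β ^ (-(9 * (L : ℝ) ^ 4 - 1)) :=
    mul_nonneg (mul_nonneg hc.le hE.le) (Real.rpow_nonneg hβ0.le _)
  -- the exponent bookkeeping `β^{−(9L⁴−1)} = β^{−1/2} · β^{−(9L⁴−3/2)}`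
  have hsplit : β ^ (-(9 * (L : ℝ) ^ 4 - 1)) = β ^ (-(1 / 2 : ℝ)) * β ^ (-(9 * (L : ℝ) ^ 4 - 3 / 2)) := by
    rw [← Real.rpow_add hβ0]; congr 1; ring
  have hratio : c / C * (β ^ (-(1 / 2 : ℝ)) / Real.log β) =
      (c * Real.exp (12 * β * (L : ℝ) ^ 4) * β ^ (-(9 * (L : ℝ) ^ 4 - 1))) /
        (C * Real.exp (12 * β * (L : ℝ) ^ 4) * β ^ (-(9 * (L : ℝ) ^ 4 - 3 / 2)) * Real.log β) := by
    rw [hsplit]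
    field_simp
  rw [hratio]
  exact div_le_div₀ (le_trans hV0 hV) hV hZ hU

/-- **`∃`-packaged form**: from `∃ C, β₁` (periodic ceiling with log) and `∃ c, β₂` (swap floor) to `∃ κ > 0, β₀` with `κ·β^{−1/2}/log β ≤ Z^S/Z` for
`β ≥ β₀`. [folklore] -/
theorem twistRatio_floor_of_exists (hL : 1 ≤ L)
    (hceil : ∃ C : ℝ, 0 < C ∧ ∃ β₁ : ℝ, ∀ β : ℝ, β₁ ≤ β →
      TT.physTrace L β (2 * L) ≤ C * Real.exp (12 * β * (L : ℝ) ^ 4) * β ^ (-(9 * (L : ℝ) ^ 4 - 3 / 2)) * Real.log β)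
    (hfloor : ∃ c : ℝ, 0 < c ∧ ∃ β₂ : ℝ, ∀ β : ℝ, β₂ ≤ β →
      c * Real.exp (12 * β * (L : ℝ) ^ 4) * β ^ (-(9 * (L : ℝ) ^ 4 - 1)) ≤ TT.twistTrace L β (2 * L)) :
    ∃ κ : ℝ, 0 < κ ∧ ∃ β₀ : ℝ, ∀ β : ℝ, β₀ ≤ β →
      κ * (β ^ (-(1 / 2 : ℝ)) / Real.log β) ≤ TT.twistTrace L β (2 * L) / TT.physTrace L β (2 * L) := by
  obtain ⟨C, hC, β₁, hceil⟩ := hceil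
  obtain ⟨c, hc, β₂, hfloor⟩ := hfloor
  exact ⟨c / C, div_pos hc hC, max (max β₁ β₂) 2, twistRatio_floor_of_bounds hL hc hC hceil hfloor⟩

end Summit.QuantumFields.YangMills.Theorems.SwapTwistDeficit.TwistRatioFloor

end
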